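import Summits.KontsevichZagierPeriods.KontsevichZagierPeriods.Theses.HurwitzMicroSectors
import Summits.KontsevichZagierPeriods.KontsevichZagierPeriods.Theorems.SectorTwoSix.Negative.LoadBearing
import Literature.NumberTheory.Transcendental.CalegariDimitrovTangL2Chi3
import Literature.NumberTheory.Transcendental.BoxIntegralHurwitzWeightTwo
import Literature.NumberTheory.Transcendental.BoxCoordinatePowerMap
import Literature.NumberTheory.Transcendental.KZLogCalculusProofs
import Literature.NumberTheory.Transcendental.KZRelationsLE

/-!
# `SectorTwoSix` (stmt-KontsevichZagierPeriods-3870) — line `jacobian-monomial-absorption`: SKELETON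

Crux (route HurwitzMicroSectors, rank 2): under Calegari–Dimitrov–Tang's Theorem 1 (`1, π², L(2,χ₋₃)`
`ℚ`-linearly independent), two representations on the open box `(0,1)²` with integrands
`P(x₀x₁)/(1−(x₀x₁)⁶)`, `P'(x₀x₁)/(1−(x₀x₁)⁶)` (`P, P' ∈ ℚ[t]`) and equal values are KZ-equivalent.

Line (lever): every relation of the reduction is ONE change of variables along the diagonal power map
`Φₘ(x) = (x₀ᵐ, x₁ᵐ)` of the open box (Jacobian `m² tᵐ⁻¹`, `t = x₀x₁`): the level-6 distribution
relations (`m = 2, 3`) AND the monomial evaluations `[box, tᵏ] ∼ [box, (k+1)⁻²]` (`m = k + 1`, constant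
target integrand) — no Newton–Leibniz move, no change of dimension, one domain throughout. Composition:
engine (`stub_dilationTwo`) → single-move targets on canonical representations (`stub_targets`) →
reduction of every numerator to the normal form `a(1−t⁶) + bt³ + ct⁵` in `FormalRep ⧸ relations`
(`stub_reduce`; additivity = rule 1b, `ℚ`-homogeneity = the tree's `KZ.scale`) → value of the normal
form `a + bH₃ + cH₅` (`stub_nfValue`, tree level-6 values) → rigidity under CDT (`stub_rigid`) →
`SectorTwoSix_of`. Canonical representations `sectorRep P = [box, P(t)/(1−t⁶)]` are the landed
`Theorems/SectorTwoSix/Negative/LoadBearing.lean` ones; nothing is defined here.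
-/

noncomputable section

open Set MeasureTheory Polynomial
open Literature.NumberTheory.Transcendental
open Summit.KontsevichZagierPeriods.Theorems.SectorTwoSix.Negative

namespace Summit.KontsevichZagierPeriods.Theorems.HurwitzMicroSectorsSectorTwoSix

open Summit.KontsevichZagierPeriods.KontsevichZagierPeriods.Theses.HurwitzMicroSectors (SectorTwoSix)

/-- STUB (engine, `n = 2` dilation move): for representations `r, r'` on the open unit box with
`r.integrand x = r'.integrand (x₀ᵐ, x₁ᵐ) · m² (x₀x₁)ᵐ⁻¹` on the box (`m ≥ 1`), `[r] − [r']` is ONE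
change-of-variables move (tree `BoxCoordinatePowerMap`: `Φₘ` polynomial hence `ℚ`-semialgebraic,
injective on the box, `Φₘ '' box = box`, `|det Φₘ'| = m² tᵐ⁻¹`). -/
theorem stub_dilationTwo : ∀ (m : ℕ), 1 ≤ m → ∀ (r r' : KZ.IntegralRep 2),
    r.domain = {x | ∀ i, x i ∈ Set.Ioo (0:ℝ) 1} → r'.domain = {x | ∀ i, x i ∈ Set.Ioo (0:ℝ) 1} →
    (∀ x ∈ r.domain, r.integrand x =
      r'.integrand (fun i => x i ^ m) * ((m : ℝ) ^ 2 * (x 0 * x 1) ^ (m - 1))) →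
    KZ.of r - KZ.of r' ∈ KZ.changeOfVariablesRel := by
  sorry

/-- STUB (the single-move targets on canonical representations, from the engine): the monomial
evaluation `[box, (tᵏ − tᵏ⁺⁶)/(1−t⁶)] = [box, tᵏ] ∼ [box, (k+1)⁻²] = [box, (k+1)⁻²(1−t⁶)/(1−t⁶)]`
(`m = k+1`), the `m = 2` dilations `[4t²ˢ⁺¹] ∼ [tˢ + tˢ⁺³]` and the `m = 3` dilations
`[9t³ˢ⁺²] ∼ [tˢ + tˢ⁺² + tˢ⁺⁴]`, each ONE move, hence a relation. -/
theorem stub_targets :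
    (∀ (m : ℕ), 1 ≤ m → ∀ (r r' : KZ.IntegralRep 2),
      r.domain = {x | ∀ i, x i ∈ Set.Ioo (0:ℝ) 1} → r'.domain = {x | ∀ i, x i ∈ Set.Ioo (0:ℝ) 1} →
      (∀ x ∈ r.domain, r.integrand x =
        r'.integrand (fun i => x i ^ m) * ((m : ℝ) ^ 2 * (x 0 * x 1) ^ (m - 1))) →
      KZ.of r - KZ.of r' ∈ KZ.changeOfVariablesRel) →
    (∀ k : ℕ, KZ.of (sectorRep (X ^ k - X ^ (k + 6))) -
        KZ.of (sectorRep (C (1 / ((k : ℚ) + 1) ^ 2) * (1 - X ^ 6))) ∈ KZ.relations) ∧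
    (∀ s : ℕ, KZ.of (sectorRep (4 * X ^ (2 * s + 1))) -
        KZ.of (sectorRep (X ^ s + X ^ (s + 3))) ∈ KZ.relations) ∧
    (∀ s : ℕ, KZ.of (sectorRep (9 * X ^ (3 * s + 2))) -
        KZ.of (sectorRep (X ^ s + X ^ (s + 2) + X ^ (s + 4))) ∈ KZ.relations) := by
  sorry

/-- STUB (reduction, the hardest): from the targets, every numerator `P ∈ ℚ[t]` is equivalent to a
normal form `a(1−t⁶) + bt³ + ct⁵` (partial fractions and rational rescalings inside the calculus:
rule 1b and the tree's scaling endomorphism `KZ.scale`; the six residues `t⁰…t⁵` by the four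
distribution relations, the shift `tᵏ⁺⁶ = tᵏ − (k+1)⁻²(1−t⁶)` by the monomial evaluation). -/
theorem stub_reduce :
    (∀ k : ℕ, KZ.of (sectorRep (X ^ k - X ^ (k + 6))) -
        KZ.of (sectorRep (C (1 / ((k : ℚ) + 1) ^ 2) * (1 - X ^ 6))) ∈ KZ.relations) →
    (∀ s : ℕ, KZ.of (sectorRep (4 * X ^ (2 * s + 1))) -
        KZ.of (sectorRep (X ^ s + X ^ (s + 3))) ∈ KZ.relations) →
    (∀ s : ℕ, KZ.of (sectorRep (9 * X ^ (3 * s + 2))) -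
        KZ.of (sectorRep (X ^ s + X ^ (s + 2) + X ^ (s + 4))) ∈ KZ.relations) →
    ∀ P : ℚ[X], ∃ a b c : ℚ,
      KZ.of (sectorRep P) - KZ.of (sectorRep (C a * (1 - X ^ 6) + C b * X ^ 3 + C c * X ^ 5)) ∈
        KZ.relations := by
  sorry

/-- STUB (value of the normal form): `∫_box (a(1−t⁶) + bt³ + ct⁵)/(1−t⁶) = a + bH₃ + cH₅` with the
tree's `H₃ = −L(2,χ₋₃)/8 + π²/54`, `H₅ = π²/216` (`BoxIntegral.setIntegral_box_level_six_three/five`). -/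
theorem stub_nfValue : ∀ a b c : ℚ,
    (sectorRep (C a * (1 - X ^ 6) + C b * X ^ 3 + C c * X ^ 5)).value =
      (a : ℝ) + b * (-(L2chi3 / 8) + Real.pi ^ 2 / 54) + c * (Real.pi ^ 2 / 216) := by
  sorry

/-- STUB (rigidity under CDT): `1, H₃, H₅` are `ℚ`-independent iff `1, π², L(2,χ₋₃)` are, so equal
values of two normal forms force equal coefficients (`calegariDimitrovTang_linearIndependent.eq_zero`). -/
theorem stub_rigid : calegariDimitrovTang_linearIndependent → ∀ a b c a' b' c' : ℚ,
    (a : ℝ) + b * (-(L2chi3 / 8) + Real.pi ^ 2 / 54) + c * (Real.pi ^ 2 / 216) =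
      (a' : ℝ) + b' * (-(L2chi3 / 8) + Real.pi ^ 2 / 54) + c' * (Real.pi ^ 2 / 216) →
    a = a' ∧ b = b' ∧ c = c' := by
  sorry

/-- **The crux from the stubs.** Given CDT and two sector representations `r, r'` with equal values:
replace them by the canonical `sectorRep P`, `sectorRep P'` (off-domain freedom is a rule-1b relation,
`KZ.of_sub_of_mem_relations_of_eqOn`), reduce both numerators to normal forms (`stub_reduce` fed by
`stub_targets` fed by `stub_dilationTwo`), read the values (`stub_nfValue`, soundness
`KZ.Equivalent.value_eq_holds`), compare coefficients (`stub_rigid`), and compose the chain. -/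
theorem SectorTwoSix_of : SectorTwoSix := by
  intro hCDT r r' P P' hd hd' hf hf' hv
  obtain ⟨hM, h2, h3⟩ := stub_targets stub_dilationTwo
  obtain ⟨a, b, c, hP⟩ := stub_reduce hM h2 h3 P
  obtain ⟨a', b', c', hP'⟩ := stub_reduce hM h2 h3 P'
  have h1 : KZ.of r - KZ.of (sectorRep P) ∈ KZ.relations :=
    KZ.of_sub_of_mem_relations_of_eqOn (by rw [sectorRep_domain, hd]; rfl) fun x hx => hf hx
  have h1' : KZ.of r' - KZ.of (sectorRep P') ∈ KZ.relations :=
    KZ.of_sub_of_mem_relations_of_eqOn (by rw [sectorRep_domain, hd']; rfl) fun x hx => hf' hx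
  have hvr : r.value = (sectorRep (C a * (1 - X ^ 6) + C b * X ^ 3 + C c * X ^ 5)).value :=
    (KZ.Equivalent.value_eq_holds h1).trans (KZ.Equivalent.value_eq_holds hP)
  have hvr' : r'.value = (sectorRep (C a' * (1 - X ^ 6) + C b' * X ^ 3 + C c' * X ^ 5)).value :=
    (KZ.Equivalent.value_eq_holds h1').trans (KZ.Equivalent.value_eq_holds hP')
  rw [stub_nfValue] at hvr hvr'
  obtain ⟨rfl, rfl, rfl⟩ := stub_rigid hCDT a b c a' b' c' (by rw [← hvr, ← hvr', hv])
  have : KZ.of r - KZ.of r' = (KZ.of r - KZ.of (sectorRep P)) +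
      (KZ.of (sectorRep P) - KZ.of (sectorRep (C a * (1 - X ^ 6) + C b * X ^ 3 + C c * X ^ 5))) -
      (KZ.of (sectorRep P') - KZ.of (sectorRep (C a * (1 - X ^ 6) + C b * X ^ 3 + C c * X ^ 5))) -
      (KZ.of r' - KZ.of (sectorRep P')) := by abel
  show KZ.of r - KZ.of r' ∈ KZ.relations
  rw [this]
  exact KZ.relations.sub_mem (KZ.relations.sub_mem (KZ.relations.add_mem h1 hP) hP') h1'

end Summit.KontsevichZagierPeriods.Theorems.HurwitzMicroSectorsSectorTwoSix

end
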